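import Summits.CriticalPhenomena.PercolationContinuityZ3.Theorems.Transplant.SqShadowSurgeryAtt
import HarnessLib

/-!
# SQUARE SHADOWS — port of «HexShadowVSurgeryData» to the square-shadow interface `SqShadow` (statements and proofs verbatim with `Ψ : SqShadow G` for `Φ : HexShadow G`; gen 42, seat prim-bschramm-p2; helper file `--supports stmt-CriticalPhenomena-4575 --as helper`)


# HEXAGONAL SHADOWS XLIV — the local surgery with a cleared VERTEX set (core I: data and the new configuration)

builds on p205010 (kernel theorem, internal audit signed; external expert review pending) — NOT used in this file.  Lane `prim-bschramm`, seat
`prim-bschramm-p2` (gen 34; class C1b; memo `HOME/bschramm/P2-LATTICES.md` §125); helper file (`--supports stmt-CriticalPhenomena-4575 --as helper`).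

WHY.  The surgery of «HexShadowSurgeryData» clears a set `D` of COLUMNS (`D̄ = Φ.lift D`).  For the `(111)`-films `F_k` every column-complete block has
boundary vertices of block-degree `1` (the extreme-level vertices over the corners of the hexagon — no vertical edges in `F_k`), and the routing node
`LocalLinkage` is false there (gen 33, memo §124).  The repair is to clear an arbitrary VERTEX set `W ⊆ \overline{big ∪ small}` (the instance removes the
few degenerate vertices from the lifted block): this file is «HexShadowSurgeryData» VERBATIM with the predicate `Φ.sh x ∈ D` replaced by `x ∈ W`
(`HexShadow.VSurgery`, `HexShadow.touchV`, `newConfig = (ω ∖ touchV W) ∪ structEdges ∪ stubs`, locality, `newConfig_lattice`, `mem_Sw_of_edge`).  The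
located-output interface `HexShadow.SurgOut` of «HexShadowSurgOut» is unchanged, so «HexShadowFact2Reduction» applies to vertex-set surgeries as it stands
(«HexShadowVSurgeryAtt»: `VSurgery.surgOut`).
[cite: DuminilCopinSidoraviciusTassion2016, §2.3 (proof of Fact 2, pp. 6–7)] [cite: NewmanTassionWu2017, §3.2 (proof of Thm. 3.9, steps (1)–(3))]
-/

noncomputable section

namespace Summit.CriticalPhenomena.PercolationContinuityZ3.Theorems.Transplant

open MeasureTheory Literature.Probability.Percolation Literature.Probability.LatticeModels SimpleGraph Filter
open scoped Classical Topology


/-- The lattice pairs touching the cleared vertex set `W` (the edges reset by the surgery).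
[cite: DuminilCopinSidoraviciusTassion2016, §2.3, proof of Fact 2 ("Close all edges in `B̄_R(z)`")] -/
def SqShadow.touchV {V : Type} (W : Set V) : Set (Sym2 V) := {e | ∃ x, x ∈ e ∧ x ∈ W}


/-- Membership of a pair in `touchV W`. [folklore] -/
@[simp] theorem SqShadow.mk_mem_touchV_iff {V : Type} {W : Set V} {a b : V} :
    s(a, b) ∈ SqShadow.touchV W ↔ a ∈ W ∨ b ∈ W := by
  constructor
  · rintro ⟨x, hx, hxW⟩
    rcases Sym2.mem_iff.1 hx with rfl | rfl
    · exact Or.inl hxW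
    · exact Or.inr hxW
  · rintro (h | h)
    · exact ⟨a, Sym2.mem_mk_left _ _, h⟩
    · exact ⟨b, Sym2.mem_mk_right _ _, h⟩

/-- `touchV` is monotone. [folklore] -/
theorem SqShadow.touchV_mono {V : Type} {W W' : Set V} (h : W ⊆ W') : SqShadow.touchV W ⊆ SqShadow.touchV W' := by
  rintro e ⟨x, hx, hxW⟩; exact ⟨x, hx, h hxW⟩

/-- Pairs touching a subset of `Ψ.lift D` touch the columns `D`. [folklore] -/
theorem SqShadow.touchV_subset_touch {V : Type} {G : SimpleGraph V} (Ψ : SqShadow G) {W : Set V} {D : Set (Site 2)} (h : W ⊆ Ψ.lift D) :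
    SqShadow.touchV W ⊆ Ψ.touch D := by
  rintro e ⟨x, hx, hxW⟩
  exact ⟨x, hx, by have := h hxW; rwa [SqShadow.mem_lift] at this⟩


/-- **The data of one local surgery with a cleared VERTEX set** (DST 2016, §2.3, proof of Fact 2, pp. 6–7; NTW 2017, §3.2, proof of
Thm. 3.9, steps (1)–(3)): «HexShadowSurgeryData»'s `SqShadow.Surgery` with the cleared columns `D` (`D̄ = Ψ.lift D`) replaced by a cleared vertex
set `W ⊆ \overline{B_{3n} ∪ B'_n}`.  For `ω ∈ 𝒳` with `γ = γ_min(ω) = p₀ ++ E₁ :: mid ++ E₂ :: s₀`: `W` is met by `γ` first at `E₁` and last at `E₂`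
(`p₀, s₀` off `W`, non-empty); a rerouted piece `P` (inside `W ∩ B̄_{3n}`, off `Z̄_n`) with `E₁ :: P ++ [E₂]` a self-avoiding lattice chain; an
attachment vertex `c ∈ E₁ :: P` and a branch `Br` (a self-avoiding lattice chain from a neighbour of `c` to `w' = Br.last`, inside `W`, off
`E₁ :: P ++ [E₂]`); DST's condition "`(z,v) ≺ (z,w)`" as `key (successor of c) < key (Br.head)`; the key condition for structure vertices over
`S_{3n}`; the `S'`-side `ω`-open path `σ` from `w'` to `S̄'_n` inside `B̄'_n`, off the columns of `γ`, leaving `W` after its first vertex.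
[cite: DuminilCopinSidoraviciusTassion2016, §2.3, proof of Fact 2 (pp. 6–7)] [cite: NewmanTassionWu2017, §3.2 (proof of Thm. 3.9, steps (1)–(3))] -/
structure SqShadow.VSurgery {V : Type} {G : SimpleGraph V} (Ψ : SqShadow G) [Countable V] (Γ : GlueData) (ω : BondConfig V) where
  /-- the cleared vertices -/
  W : Set V
  /-- `γ_min(ω)` before its first visit to `W` -/
  p₀ : List V
  /-- the first vertex of `γ_min(ω)` in `W` -/
  E₁ : V
  /-- `γ_min(ω)` strictly between `E₁` and `E₂` -/
  mid : List V
  /-- the last vertex of `γ_min(ω)` in `W` -/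
  E₂ : V
  /-- `γ_min(ω)` after its last visit to `W` -/
  s₀ : List V
  /-- the rerouted piece (strictly between `E₁` and `E₂`) -/
  P : List V
  /-- the attachment vertex -/
  c : V
  /-- the branch, from a neighbour of `c` to `w'` -/
  Br : List V
  /-- the `S'`-side path from `w'` -/
  σ : List V
  hW : W ⊆ Ψ.lift (Ψ.big Γ ∪ Ψ.small Γ)
  hγ : Ψ.γmin Γ ω = p₀ ++ E₁ :: (mid ++ E₂ :: s₀)
  hp₀ : p₀ ≠ []
  hs₀ : s₀ ≠ []
  hp₀W : ∀ x ∈ p₀, x ∉ W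
  hs₀W : ∀ x ∈ s₀, x ∉ W
  hE₁W : E₁ ∈ W
  hE₂W : E₂ ∈ W
  hPW : ∀ x ∈ P, x ∈ W
  hPbig : ∀ x ∈ P, Ψ.sh x ∈ (Ψ.big Γ)
  hPY : ∀ x ∈ P, Ψ.sh x ∉ (Ψ.zSeg Γ)
  hSPchain : (E₁ :: (P ++ [E₂])).IsChain (fun a b => G.Adj a b)
  hSPnodup : (E₁ :: (P ++ [E₂])).Nodup
  hc : c ∈ E₁ :: P
  hBr : Br ≠ []
  hBrW : ∀ x ∈ Br, x ∈ W
  hBrchain : (c :: Br).IsChain (fun a b => G.Adj a b)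
  hBrnodup : (c :: Br).Nodup
  hBrSP : ∀ x ∈ Br, x ∉ E₁ :: (P ++ [E₂])
  hfwd : ∀ (l₁ l₂ : List V) (y : V), E₁ :: (P ++ [E₂]) = l₁ ++ c :: y :: l₂ →
    vtxKey V y < vtxKey V (Br.head hBr)
  hsrc : ∀ v ∈ P ++ Br.dropLast, v ∈ Ψ.lift (Ψ.src Γ) → v ∉ Ψ.γmin Γ ω →
    ∀ b ∈ (Ψ.γmin Γ ω).head?, vtxKey V b ≤ vtxKey V v
  hσ : σ.head? = some (Br.getLast hBr)
  hσchain : σ.IsChain (fun a b => s(a, b) ∈ ω ∧ a ≠ b)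
  hσsmall : ∀ x ∈ σ, Ψ.sh x ∈ (Ψ.small Γ)
  hσγ : ∀ x ∈ σ, Ψ.sh x ∉ Ψ.γcols Γ ω
  hσW : ∀ x ∈ σ.tail, x ∉ W
  hσsrc' : ∀ h : σ ≠ [], σ.getLast h ∈ Ψ.lift (Ψ.src' Γ)

namespace SqShadow.VSurgery

variable {V : Type} {G : SimpleGraph V} {Ψ : SqShadow G} [Countable V] {Γ : GlueData} {ω : BondConfig V}

/-- The rerouted structure path `E₁ :: P ++ [E₂]`. [cite: DuminilCopinSidoraviciusTassion2016, §2.3, proof of Fact 2] -/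
def SP (sg : Ψ.VSurgery Γ ω) : List V := sg.E₁ :: (sg.P ++ [sg.E₂])

/-- The end `w'` of the branch. [cite: DuminilCopinSidoraviciusTassion2016, §2.3, proof of Fact 2] -/
def w' (sg : Ψ.VSurgery Γ ω) : V := sg.Br.getLast sg.hBr

/-- The new (opened) edges: those of the structure path and of the branch. [cite: DuminilCopinSidoraviciusTassion2016, §2.3, proof of Fact 2 ("Open the edges …")] -/
def structEdges (sg : Ψ.VSurgery Γ ω) : Set (Sym2 V) := edgesOf sg.SP ∪ edgesOf (sg.c :: sg.Br)

/-- The kept edges entering `W`: the edge of `γ` into `E₁`, the edge of `γ` out of `E₂`, and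
the first edge of `σ` (out of `w'`). [cite: DuminilCopinSidoraviciusTassion2016, §2.3, proof of Fact 2] -/
def stubs (sg : Ψ.VSurgery Γ ω) : Set (Sym2 V) :=
  {s(sg.p₀.getLast sg.hp₀, sg.E₁), s(sg.E₂, sg.s₀.head sg.hs₀)} ∪
    {e | ∃ w₂ ∈ sg.σ.tail.head?, e = s(sg.w', w₂)}

/-- **The new configuration `ω^{(z)}`**: close every edge touching `W`, then open the structure
edges and the three stubs. [cite: DuminilCopinSidoraviciusTassion2016, §2.3, proof of Fact 2 (pp. 6–7)] -/
def newConfig (sg : Ψ.VSurgery Γ ω) : BondConfig V := (ω \ SqShadow.touchV sg.W) ∪ sg.structEdges ∪ sg.stubs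

/-- The structure vertices. [cite: DuminilCopinSidoraviciusTassion2016, §2.3, proof of Fact 2] -/
def Sw (sg : Ψ.VSurgery Γ ω) : Set V := {x | x ∈ sg.SP ∨ x ∈ sg.Br}

/-! ### Elementary consequences of the data -/

/-- `σ` is non-empty. [folklore] -/
theorem σ_ne_nil (sg : Ψ.VSurgery Γ ω) : sg.σ ≠ [] := by
  intro h; have := sg.hσ; rw [h] at this; simp at this

/-- `σ` starts at `w'`. [folklore] -/
theorem σ_head (sg : Ψ.VSurgery Γ ω) : sg.σ.head sg.σ_ne_nil = sg.w' := by
  have := sg.hσ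
  rw [List.head?_eq_some_head sg.σ_ne_nil, Option.some.injEq] at this
  exact this

/-- `w' ∈ Br`. [folklore] -/
private theorem w'_mem_Br (sg : Ψ.VSurgery Γ ω) : sg.w' ∈ sg.Br := List.getLast_mem sg.hBr

/-- `w' ∈ σ`. [folklore] -/
private theorem w'_mem_σ (sg : Ψ.VSurgery Γ ω) : sg.w' ∈ sg.σ := by rw [← sg.σ_head]; exact List.head_mem _

/-- `E₁` lies on the structure path. [folklore] -/
private theorem E₁_mem_SP (sg : Ψ.VSurgery Γ ω) : sg.E₁ ∈ sg.SP := by simp [SP]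

/-- `E₂` lies on the structure path. [folklore] -/
private theorem E₂_mem_SP (sg : Ψ.VSurgery Γ ω) : sg.E₂ ∈ sg.SP := by simp [SP]

/-- `c` lies on the structure path. [folklore] -/
private theorem c_mem_SP (sg : Ψ.VSurgery Γ ω) : sg.c ∈ sg.SP := by
  rcases List.mem_cons.1 sg.hc with h | h
  · rw [h]; exact sg.E₁_mem_SP
  · simp [SP, h]

/-- Membership in the structure path. [folklore] -/
theorem mem_SP_iff (sg : Ψ.VSurgery Γ ω) {x : V} : x ∈ sg.SP ↔ x = sg.E₁ ∨ x ∈ sg.P ∨ x = sg.E₂ := by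
  simp [SP]

/-- The structure path lies in `W`. [folklore] -/
theorem SP_W (sg : Ψ.VSurgery Γ ω) {x : V} (hx : x ∈ sg.SP) : x ∈ sg.W := by
  rcases sg.mem_SP_iff.1 hx with rfl | h | rfl
  · exact sg.hE₁W
  · exact sg.hPW x h
  · exact sg.hE₂W

/-- Structure vertices lie in `W`. [folklore] -/
theorem Sw_W (sg : Ψ.VSurgery Γ ω) {x : V} (hx : x ∈ sg.Sw) : x ∈ sg.W := by
  rcases hx with h | h
  · exact sg.SP_W h
  · exact sg.hBrW x h

/-- `w'` is a structure vertex. [folklore] -/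
private theorem w'_mem_Sw (sg : Ψ.VSurgery Γ ω) : sg.w' ∈ sg.Sw := Or.inr sg.w'_mem_Br

/-- `w'` lies in `W`. [folklore] -/
theorem w'_W (sg : Ψ.VSurgery Γ ω) : sg.w' ∈ sg.W := sg.hBrW _ sg.w'_mem_Br

/-- The attachment vertex is not `E₂`. [folklore] -/
private theorem c_ne_E₂ (sg : Ψ.VSurgery Γ ω) : sg.c ≠ sg.E₂ := by
  intro h
  have hnd := sg.hSPnodup
  rcases List.mem_cons.1 sg.hc with h1 | h1
  · -- `E₁ = E₂`
    rw [h1] at h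
    rw [h] at hnd
    exact (List.nodup_cons.1 hnd).1 (by simp)
  · rw [h] at h1
    have := (List.nodup_cons.1 hnd).2
    rw [List.nodup_append] at this
    exact this.2.2 _ h1 _ (by simp) rfl

/-- `E₁ ≠ E₂`. [folklore] -/
private theorem E₁_ne_E₂ (sg : Ψ.VSurgery Γ ω) : sg.E₁ ≠ sg.E₂ := by
  intro h
  have hnd := sg.hSPnodup
  rw [h] at hnd
  exact (List.nodup_cons.1 hnd).1 (by simp)

/-- `w'` is off the structure path. [folklore] -/
private theorem w'_not_mem_SP (sg : Ψ.VSurgery Γ ω) : sg.w' ∉ sg.SP := sg.hBrSP _ sg.w'_mem_Br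

/-- The last vertex of `p₀` is off `W`. [folklore] -/
theorem p₀_last_not_W (sg : Ψ.VSurgery Γ ω) : sg.p₀.getLast sg.hp₀ ∉ sg.W := sg.hp₀W _ (List.getLast_mem _)

/-- The first vertex of `s₀` is off `W`. [folklore] -/
theorem s₀_head_not_W (sg : Ψ.VSurgery Γ ω) : sg.s₀.head sg.hs₀ ∉ sg.W := sg.hs₀W _ (List.head_mem _)

/-- The new edges join structure vertices. [folklore] -/
theorem structEdges_Sw (sg : Ψ.VSurgery Γ ω) {a b : V} (h : s(a, b) ∈ sg.structEdges) : a ∈ sg.Sw ∧ b ∈ sg.Sw := by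
  rcases h with h | h
  · obtain ⟨ha, hb⟩ := mem_of_mem_edgesOf h
    exact ⟨Or.inl ha, Or.inl hb⟩
  · obtain ⟨ha, hb⟩ := mem_of_mem_edgesOf h
    refine ⟨?_, ?_⟩
    · rcases List.mem_cons.1 ha with rfl | ha
      · exact Or.inl sg.c_mem_SP
      · exact Or.inr ha
    · rcases List.mem_cons.1 hb with rfl | hb
      · exact Or.inl sg.c_mem_SP
      · exact Or.inr hb

/-- The stubs are `ω`-open. [folklore] -/
theorem stubs_subset (sg : Ψ.VSurgery Γ ω) (hA : ω ∈ Ψ.evA Γ) : sg.stubs ⊆ ω := by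
  have hγO := (Ψ.γmin_spec Γ hA).1
  have hch := hγO.chain
  rw [sg.hγ] at hch
  rintro e (he | ⟨w₂, hw₂, rfl⟩)
  · rcases he with rfl | rfl
    · -- the edge of `γ` into `E₁`
      obtain ⟨q, hq⟩ := List.exists_cons_of_ne_nil sg.hp₀ |>.imp fun _ h => h
      have h1 := List.isChain_append.1 hch
      have := h1.2.2 (sg.p₀.getLast sg.hp₀) (by rw [List.getLast?_eq_some_getLast sg.hp₀]; rfl) sg.E₁ (by simp)
      exact this.1
    · -- the edge of `γ` out of `E₂`
      have h1 := (List.isChain_append.1 hch).2.1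
      rw [List.isChain_cons] at h1
      have h2 := h1.2
      have h3 := List.isChain_append.1 (show (sg.mid ++ sg.E₂ :: sg.s₀).IsChain _ from h2)
      have h4 := h3.2.1
      rw [List.isChain_cons] at h4
      have := h4.1 (sg.s₀.head sg.hs₀) (by rw [List.head?_eq_some_head sg.hs₀]; rfl)
      exact this.1
  · -- the first edge of `σ`
    have hσ := sg.hσchain
    have hh := sg.hσ
    rcases hσeq : sg.σ with _ | ⟨x, _ | ⟨y, t⟩⟩
    · rw [hσeq] at hh; simp at hh
    · rw [hσeq] at hw₂; simp at hw₂
    · rw [hσeq] at hh hw₂ hσ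
      simp only [List.head?_cons, Option.some.injEq] at hh
      simp only [List.tail_cons, List.head?_cons, Option.mem_def, Option.some.injEq] at hw₂
      subst hh; subst hw₂
      exact (List.isChain_cons_cons.1 hσ).1.1

/-- The endpoints of a stub: one of `E₁, E₂, w'` and its partner outside `W`. [folklore] -/
theorem stubs_cases (sg : Ψ.VSurgery Γ ω) {q x : V} (h : s(q, x) ∈ sg.stubs) :
    (x = sg.E₁ ∧ q = sg.p₀.getLast sg.hp₀) ∨ (q = sg.E₁ ∧ x = sg.p₀.getLast sg.hp₀) ∨
    (x = sg.E₂ ∧ q = sg.s₀.head sg.hs₀) ∨ (q = sg.E₂ ∧ x = sg.s₀.head sg.hs₀) ∨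
    (x = sg.w' ∧ q ∈ sg.σ.tail.head?) ∨ (q = sg.w' ∧ x ∈ sg.σ.tail.head?) := by
  rcases h with h | ⟨w₂, hw₂, h⟩
  · rcases h with h | h
    · rcases Sym2.eq_iff.1 h with ⟨rfl, rfl⟩ | ⟨rfl, rfl⟩
      · exact Or.inl ⟨rfl, rfl⟩
      · exact Or.inr (Or.inl ⟨rfl, rfl⟩)
    · rcases Sym2.eq_iff.1 h with ⟨rfl, rfl⟩ | ⟨rfl, rfl⟩
      · exact Or.inr (Or.inr (Or.inr (Or.inl ⟨rfl, rfl⟩)))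
      · exact Or.inr (Or.inr (Or.inl ⟨rfl, rfl⟩))
  · rcases Sym2.eq_iff.1 h with ⟨rfl, rfl⟩ | ⟨rfl, rfl⟩
    · exact Or.inr (Or.inr (Or.inr (Or.inr (Or.inr ⟨rfl, hw₂⟩))))
    · exact Or.inr (Or.inr (Or.inr (Or.inr (Or.inl ⟨rfl, hw₂⟩))))

/-- The second vertex of `σ` is off `W`. [folklore] -/
theorem σ₂_not_W (sg : Ψ.VSurgery Γ ω) {w₂ : V} (h : w₂ ∈ sg.σ.tail.head?) : w₂ ∉ sg.W :=
  sg.hσW _ (List.mem_of_mem_head? h)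

/-- A stub entering a vertex of `W` enters `E₁`, `E₂` or `w'`, from its fixed partner. [folklore] -/
theorem stubs_cases_W (sg : Ψ.VSurgery Γ ω) {q x : V} (h : s(q, x) ∈ sg.stubs) (hx : x ∈ sg.W) :
    (x = sg.E₁ ∧ q = sg.p₀.getLast sg.hp₀) ∨ (x = sg.E₂ ∧ q = sg.s₀.head sg.hs₀) ∨
    (x = sg.w' ∧ q ∈ sg.σ.tail.head?) := by
  rcases sg.stubs_cases h with h | ⟨-, rfl⟩ | h | ⟨-, rfl⟩ | h | ⟨-, h⟩
  · exact Or.inl h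
  · exact absurd hx sg.p₀_last_not_W
  · exact Or.inr (Or.inl h)
  · exact absurd hx sg.s₀_head_not_W
  · exact Or.inr (Or.inr h)
  · exact absurd hx (sg.σ₂_not_W h)

/-- Stubs touch `W`. [folklore] -/
theorem stubs_touch (sg : Ψ.VSurgery Γ ω) : sg.stubs ⊆ SqShadow.touchV sg.W := by
  intro e he
  induction e using Sym2.ind with
  | h q x =>
    rcases sg.stubs_cases he with ⟨rfl, -⟩ | ⟨rfl, -⟩ | ⟨rfl, -⟩ | ⟨rfl, -⟩ | ⟨rfl, -⟩ | ⟨rfl, -⟩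
    · exact SqShadow.mk_mem_touchV_iff.2 (Or.inr sg.hE₁W)
    · exact SqShadow.mk_mem_touchV_iff.2 (Or.inl sg.hE₁W)
    · exact SqShadow.mk_mem_touchV_iff.2 (Or.inr sg.hE₂W)
    · exact SqShadow.mk_mem_touchV_iff.2 (Or.inl sg.hE₂W)
    · exact SqShadow.mk_mem_touchV_iff.2 (Or.inr sg.w'_W)
    · exact SqShadow.mk_mem_touchV_iff.2 (Or.inl sg.w'_W)

/-- Structure edges touch `W`. [folklore] -/
theorem structEdges_touch (sg : Ψ.VSurgery Γ ω) : sg.structEdges ⊆ SqShadow.touchV sg.W := by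
  intro e he
  induction e using Sym2.ind with
  | h a b => exact SqShadow.mk_mem_touchV_iff.2 (Or.inl (sg.Sw_W (sg.structEdges_Sw he).1))

/-- **Locality**: off the pairs touching `W`, the new configuration is the old one. [folklore] -/
theorem mem_newConfig_iff_of_not_touch (sg : Ψ.VSurgery Γ ω) {e : Sym2 V} (he : e ∉ SqShadow.touchV sg.W) :
    e ∈ sg.newConfig ↔ e ∈ ω := by
  constructor
  · rintro ((h | h) | h)
    · exact h.1
    · exact absurd (sg.structEdges_touch h) he
    · exact absurd (sg.stubs_touch h) he
  · exact fun h => Or.inl (Or.inl ⟨h, he⟩)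

/-- `ω' ⊆ ω ∪ Enew`. [folklore] -/
theorem newConfig_subset (sg : Ψ.VSurgery Γ ω) (hA : ω ∈ Ψ.evA Γ) : sg.newConfig ⊆ ω ∪ sg.structEdges := by
  rintro e ((h | h) | h)
  · exact Or.inl h.1
  · exact Or.inr h
  · exact Or.inl (sg.stubs_subset hA h)

/-- The new configuration is a lattice configuration. [folklore] -/
theorem newConfig_lattice (sg : Ψ.VSurgery Γ ω) (hω : ω ⊆ G.edgeSet) (hA : ω ∈ Ψ.evA Γ) :
    sg.newConfig ⊆ G.edgeSet := by
  intro e he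
  rcases sg.newConfig_subset hA he with h | (h | h)
  · exact hω h
  · exact edgesOf_subset_edgeSet sg.hSPchain h
  · exact edgesOf_subset_edgeSet sg.hBrchain h

/-- A new-open pair at a vertex of `W` is a structure edge or a stub. [folklore] -/
theorem edge_at_W (sg : Ψ.VSurgery Γ ω) {q x : V} (h : s(q, x) ∈ sg.newConfig) (hx : x ∈ sg.W) :
    s(q, x) ∈ sg.structEdges ∨ s(q, x) ∈ sg.stubs := by
  rcases h with ((h | h) | h)
  · exact absurd (SqShadow.mk_mem_touchV_iff.2 (Or.inr hx)) h.2
  · exact Or.inl h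
  · exact Or.inr h

/-- **Every new-open edge into `W` ends at a structure vertex.** [folklore] -/
theorem mem_Sw_of_edge (sg : Ψ.VSurgery Γ ω) {q x : V} (h : s(q, x) ∈ sg.newConfig) (hx : x ∈ sg.W) :
    x ∈ sg.Sw := by
  rcases sg.edge_at_W h hx with h | h
  · exact (sg.structEdges_Sw h).2
  · rcases sg.stubs_cases_W h hx with ⟨rfl, -⟩ | ⟨rfl, -⟩ | ⟨rfl, -⟩
    · exact Or.inl sg.E₁_mem_SP
    · exact Or.inl sg.E₂_mem_SP
    · exact sg.w'_mem_Sw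

/-! ### Bundled membership facts (exported forms) -/

/-- `E₁, E₂, c` lie on the structure path. [folklore] -/
theorem SP_mems (sg : Ψ.VSurgery Γ ω) : sg.E₁ ∈ sg.SP ∧ sg.E₂ ∈ sg.SP ∧ sg.c ∈ sg.SP := ⟨sg.E₁_mem_SP, sg.E₂_mem_SP, sg.c_mem_SP⟩

/-- `c ≠ E₂` and `E₁ ≠ E₂`. [folklore] -/
theorem ne_facts (sg : Ψ.VSurgery Γ ω) : sg.c ≠ sg.E₂ ∧ sg.E₁ ≠ sg.E₂ := ⟨sg.c_ne_E₂, sg.E₁_ne_E₂⟩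

/-- `w'` lies on the branch, on `σ`, in the structure, and off the structure path. [folklore] -/
theorem w'_facts (sg : Ψ.VSurgery Γ ω) : sg.w' ∈ sg.Br ∧ sg.w' ∈ sg.σ ∧ sg.w' ∈ sg.Sw ∧ sg.w' ∉ sg.SP := ⟨sg.w'_mem_Br, sg.w'_mem_σ, sg.w'_mem_Sw, sg.w'_not_mem_SP⟩

end SqShadow.VSurgery


end Summit.CriticalPhenomena.PercolationContinuityZ3.Theorems.Transplant

end
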